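import Literature.MathematicalPhysics.KineticTheory.HardSphereEulerProofs
import HarnessLib

/-!
# Exchangeability of the local Gibbs law (`stub_localGibbsLawExchangeable`, helper stub H1 of the
# crux line `even-rung-mean-variance`, `JParityClosure.EvenStressEnskog`,
# stmt-AtomisticToContinuum-13079)

The local Gibbs law `localGibbsLaw σ a₀ u₀ θ₀ N Φ` of `N + 1` hard spheres is `W(z) dZ` on the phase
space `Config (N+1) (Fin 3) 𝕋³ = (𝕋³ × ℝ³)^{N+1}` restricted to the hard-sphere domain `D_ε`
(`localGibbsLaw`, `particleLaw_eq`: the Liouville measure with density `ENNReal.ofReal ∘ W`), where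
`W = Z⁻¹ 𝟙_{D_ε} ∏ᵢ a₀(xᵢ) M_{1,u₀(xᵢ),θ₀(xᵢ)}(vᵢ)` is the canonical density of the local Gibbs
profile.  `W` is a SYMMETRIC function of the labels (`canonicalDensity_comp_perm'`: the hard-sphere
domain is permutation invariant, `perm_mem_hardSphereDomain_iff`, and a product over `Fin (N+1)` is
invariant under reindexing, `isSymmetricFn_tensorPow`), and the Liouville measure is invariant under
every relabelling `z ↦ z ∘ π` (`HardSphereFlow.measurePreserving_comp_perm_liouville`).  Hence the
relabelling is measure preserving for the local Gibbs law itself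
(`measurePreserving_comp_perm_localGibbsLaw`) — for ALL profiles: no continuity, positivity or
normalisation is used — and the law is exchangeable: `∫ F(z ∘ π) dG_N = ∫ F dG_N` for every `F`
(`integral_comp_perm_localGibbsLaw`; when `F` is not integrable both sides are the junk `0` together,
`MeasurePreserving.integral_comp` along the measurable embedding `z ↦ z ∘ π`).  The registered stub
`stub_localGibbsLawExchangeable` is the instance with `F` measurable.

References: H. Spohn, *Large Scale Dynamics of Interacting Particles* (1991), Part I §2.3;
I. Gallagher, L. Saint-Raymond, B. Texier, *From Newton to Boltzmann* (2013), §1.1 (1.1.3)–(1.1.4)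
(symmetric `N`-particle densities).
-/

noncomputable section

open MeasureTheory Set
open scoped ENNReal

namespace Summit.AtomisticToContinuum.HydrodynamicLimit.Theorems.EvenStressEnskog

open Literature.Analysis.FluidPDE Literature.MathematicalPhysics.KineticTheory

/-- A measure-preserving measurable embedding `T` of `(α, μ)` into itself which leaves a density
`ρ : α → ℝ≥0∞` invariant (`ρ ∘ T = ρ`) preserves the weighted measure `μ.withDensity ρ`.  No
measurability of `ρ` is needed (change of variables along a measurable embedding,
`MeasurePreserving.setLIntegral_comp_preimage_emb`). [folklore] -/
theorem measurePreserving_withDensity_of_comp_eq {α : Type*} [MeasurableSpace α] {μ : Measure α}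
    {T : α → α} (hT : MeasurePreserving T μ μ) (hTe : MeasurableEmbedding T) {ρ : α → ℝ≥0∞}
    (hρ : ∀ x, ρ (T x) = ρ x) :
    MeasurePreserving T (μ.withDensity ρ) (μ.withDensity ρ) := by
  refine ⟨hTe.measurable, Measure.ext fun s hs => ?_⟩
  rw [Measure.map_apply hTe.measurable hs, withDensity_apply _ (hTe.measurable hs),
    withDensity_apply _ hs, ← hT.setLIntegral_comp_preimage_emb hTe ρ s]
  exact lintegral_congr fun x => (hρ x).symm

/-- The canonical Gibbs density `Z⁻¹ 𝟙_{D_ε} f₀^{⊗n}` is a symmetric function of the labels: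
`W (z ∘ π) = W z` (restated from `ShortRangePotentialsProofs.canonicalDensity_comp_perm` to keep the
imports of this file at `HardSphereEulerProofs`). [folklore] -/
theorem canonicalDensity_comp_perm' {d : Type*} [Fintype d] {X : Type*} [MeasureSpace X]
    (G : Geometry d X) (ε : ℝ) (n : ℕ) (f₀ : X × EuclideanSpace ℝ d → ℝ)
    (π : Equiv.Perm (Fin n)) (z : Config n d X) :
    canonicalDensity G ε n f₀ (z ∘ π : Config n d X) = canonicalDensity G ε n f₀ z := by
  unfold canonicalDensity
  congr 1
  have ht : tensorPow n f₀ (z ∘ π : Config n d X) = tensorPow n f₀ z :=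
    isSymmetricFn_tensorPow n f₀ π z
  by_cases hz : z ∈ hardSphereDomain G n ε
  · rw [indicator_of_mem hz, indicator_of_mem ((perm_mem_hardSphereDomain_iff π z).2 hz), ht]
  · rw [indicator_of_notMem hz,
      indicator_of_notMem (fun h => hz ((perm_mem_hardSphereDomain_iff π z).1 h))]

/-- Relabelling of the particles `z ↦ z ∘ π` is a measurable embedding of the phase space into
itself (it is the measurable equivalence `piCongrLeft` along `π⁻¹`, `exists_permEquiv`).
[folklore] -/
theorem measurableEmbedding_comp_perm {N : ℕ} (π : Equiv.Perm (Fin N)) :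
    MeasurableEmbedding (fun z : Config N (Fin 3) T3 => (z ∘ π : Config N (Fin 3) T3)) := by
  obtain ⟨e, he, -⟩ := exists_permEquiv (T3 × V3) π
  have h : (fun z : Config N (Fin 3) T3 => (z ∘ π : Config N (Fin 3) T3)) = e :=
    funext fun z => (he z).symm
  rw [h]
  exact e.measurableEmbedding

/-- **Relabelling preserves the local Gibbs law**, for all profiles `(a₀, u₀, θ₀)`, every reduced
diameter `σ`, every `N` and every permutation `π` of the `N + 1` labels: `(· ∘ π)_# G_N = G_N`.
The canonical density is label-symmetric (`canonicalDensity_comp_perm'`) and the relabelling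
preserves the Liouville measure (`HardSphereFlow.measurePreserving_comp_perm_liouville`); the flow
`Φ` only fixes the phase space. [folklore] -/
theorem measurePreserving_comp_perm_localGibbsLaw (σ : ℝ) (a₀ θ₀ : T3 → ℝ) (u₀ : T3 → V3) (N : ℕ)
    (Φ : HardSphereFlow (Torus.geometry (Fin 3)) (hsDiameter σ N) (N + 1))
    (π : Equiv.Perm (Fin (N + 1))) :
    MeasurePreserving (fun z : Config (N + 1) (Fin 3) T3 => (z ∘ π : Config (N + 1) (Fin 3) T3))
      (localGibbsLaw σ a₀ u₀ θ₀ N Φ) (localGibbsLaw σ a₀ u₀ θ₀ N Φ) := by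
  rw [localGibbsLaw, particleLaw_eq]
  exact measurePreserving_withDensity_of_comp_eq
    (HardSphereFlow.measurePreserving_comp_perm_liouville (G := Torus.geometry (Fin 3))
      (ε := hsDiameter σ N) (N := N + 1) π)
    (measurableEmbedding_comp_perm π)
    fun z => by rw [canonicalDensity_comp_perm']

/-- **Exchangeability of the local Gibbs law**: `∫ F(z ∘ π) dG_N = ∫ F dG_N` for every permutation
`π` of the labels and EVERY function `F` (no measurability or integrability needed: if `F` is not
integrable both Bochner integrals are `0`, the relabelling being a measure-preserving measurable
embedding). [folklore] -/
theorem integral_comp_perm_localGibbsLaw (σ : ℝ) (a₀ θ₀ : T3 → ℝ) (u₀ : T3 → V3) (N : ℕ)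
    (Φ : HardSphereFlow (Torus.geometry (Fin 3)) (hsDiameter σ N) (N + 1))
    (π : Equiv.Perm (Fin (N + 1))) (F : Config (N + 1) (Fin 3) T3 → ℝ) :
    ∫ z, F (z ∘ π) ∂(localGibbsLaw σ a₀ u₀ θ₀ N Φ) = ∫ z, F z ∂(localGibbsLaw σ a₀ u₀ θ₀ N Φ) :=
  (measurePreserving_comp_perm_localGibbsLaw σ a₀ θ₀ u₀ N Φ π).integral_comp
    (measurableEmbedding_comp_perm π) F

/-- **H1 · exchangeability of the local Gibbs law** (registered helper stub
`stub_localGibbsLawExchangeable` of the line `even-rung-mean-variance`): for every reduced diameter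
`σ`, all profiles `(a₀, θ₀, u₀)`, every `N`, every hard-sphere flow `Φ` (which only fixes the phase
space), every permutation `π` of the `N + 1` labels and every measurable `F`,
`∫ F(z ∘ π) d(localGibbsLaw σ a₀ u₀ θ₀ N Φ) = ∫ F d(localGibbsLaw σ a₀ u₀ θ₀ N Φ)` — the instance of
`integral_comp_perm_localGibbsLaw` (where even measurability is not needed). [folklore] -/
theorem stub_localGibbsLawExchangeable :
    ∀ (σ : ℝ) (a₀ θ₀ : T3 → ℝ) (u₀ : T3 → V3) (N : ℕ)
      (Φ : HardSphereFlow (Torus.geometry (Fin 3)) (hsDiameter σ N) (N + 1))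
      (π : Equiv.Perm (Fin (N + 1))) (F : Config (N + 1) (Fin 3) T3 → ℝ), Measurable F →
      ∫ z, F (z ∘ π) ∂(localGibbsLaw σ a₀ u₀ θ₀ N Φ) = ∫ z, F z ∂(localGibbsLaw σ a₀ u₀ θ₀ N Φ) :=
  fun σ a₀ θ₀ u₀ N Φ π F _ => integral_comp_perm_localGibbsLaw σ a₀ θ₀ u₀ N Φ π F

end Summit.AtomisticToContinuum.HydrodynamicLimit.Theorems.EvenStressEnskog

end
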